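import Literature.Computability.AlgebraicComplexity.RootLifting
import Literature.Computability.AlgebraicComplexity.ApproximativeRootClosure
import HarnessLib

/-!
# From approximate roots to a factor: the interpolation step of Kaltofen's factor theorem
# (Bürgisser 2004 §3; Dutta–Saxena–Sinhababu 2018, proof of Thm. 1), PROVED — the engine of
# `KaltofenFactorClosureProofs.lean`

Topic `Computability/AlgebraicComplexity`. This file is the field-independent ENGINE of the tree's
proof of Kaltofen's theorem "factors of polynomials with small circuits have small circuits"
(Kaltofen 1989; Bürgisser 2024, Thm. 3.2 — the tree's NAMED FACT `KaltofenFactorBoundWith` of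
`KaltofenFactorClosure.lean`, discharged over algebraically closed fields of characteristic zero in
`KaltofenFactorClosureProofs.lean`). Honest framing: a classical published theorem re-proved in
Lean; nothing here bears on `VP ≠ VNP`, which is NOT proved.

**Setting.** `F` a field, `R = F[x_β]` (`MvPolynomial β F`), `R[Y]` (`Polynomial R`), and the
"big" ring `F[x_β, y]` (`MvPolynomial (Option β) F`, `y = X none`) identified with `R[Y]` by
`optionEquivLeft`. "`u` vanishes to order `j`" means: all homogeneous components of `u` of degree
`< j` vanish (`u ∈ ⟨x⟩^j`), written out as `∀ k < j, homogeneousComponent k u = 0` (no definition).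

**What is proved** (the all-roots-to-factor step of the power-series-root approach to factoring,
Bürgisser 2004 §3 / Dutta–Saxena–Sinhababu 2018 §1.3 and proof of Thm. 1 "each factor is a
product of `(y - truncated root)` over a subset of the roots", here for ONE factor `P` singled out
by its roots at a good point):

* `KaltofenFactor.newtonRoot φ c N` — the `N`-th slow-Newton iterate
  `z_0 = c`, `z_{r+1} = z_r - ξ⁻¹ φ(z_r)`, `ξ = φ'(c)(0)` (Dvir–Shpilka–Yehudayoff 2009 Lemma 3.1,
  Dutta–Saxena–Sinhababu 2018 §1.3; the tree's `RootLifting` / `ApproximativeRootClosure`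
  iteration, given a name because three files use it). PLUMBING DEFINITION with body.
* `KaltofenFactor.coeff_vanish_of_eval_vanish` — **interpolation modulo `⟨x⟩^N`**: a polynomial
  `D ∈ R[Y]` of degree `< #S` whose values at points `z_c` (`c ∈ S ⊆ F`, `z_c(0) = c` pairwise
  distinct constant terms) all vanish to order `N` has all its coefficients vanishing to order `N`
  (factor theorem `D = (Y - z_a) D₁ + D(z_a)` and cancellation of the factor `z_c - z_a`, whose
  constant term `c - a` is a nonzero scalar — Strassen's division trick, as in
  `ApproximativeRootClosure`). [folklore]
* `KaltofenFactor.coeff_sub_prod_newtonRoot_vanish` — **a monic factor is the product of its lifted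
  roots modulo `⟨x⟩^{N+1}`**: if `P` is monic of degree `#S` in `R[Y]`, every `c ∈ S` is a root of
  `P(0, Y)` at which neither `Q(0, Y)` nor `∂_Y P(0, Y)` vanishes, then with `z_c` the `N`-th Newton
  iterate of `φ = P · Q` started at `c`, every coefficient of `P - ∏_{c ∈ S} (Y - z_c)` vanishes to
  order `N + 1`. (Newton drives `φ(z_c)` to order `N+1` — `newton_iterate_residual_vanish` of
  `ApproximativeRootClosure.lean` —; the unit `Q(z_c)` cancels; then interpolation.)
  [cite: Burgisser2004Factors, §3.2–3.3; DuttaSaxenaSinhababu2018, §1.3 and proof of Thm. 1]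
* `KaltofenFactor.eq_sum_homogeneousComponent_of_coeff_vanish` — transport to `F[x, y]`: if
  `optionEquivLeft P̂ = a₀ · P` and `deg P̂ ≤ N`, then
  `P̂ = Σ_{k ≤ N} (a₀ · ∏_{c ∈ S} (y - z_c))^{(k)}` — `P̂` IS the truncation at degree `N` of the
  product of its approximate linear factors. [folklore]
* `KaltofenFactor.complexity_le_of_rootData` — **the cost**: in that situation
  `L(P̂) ≤ (N+2)² · (#S · (N · (L(G) + 2) + 2) + #S + 1) + (N + 1)` where `optionEquivLeft G = P · Q`
  (`N` Newton substitutions per root — `RootLifting.complexity_newton_iterate_le` —, the product,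
  ONE truncation — `complexity_sum_homogeneousComponent_le`, BCS Lemma (21.25)).
  [cite: Burgisser2004Factors, Prop. 3.4 and §3.3 (cost of the Newton/product route)]

No named facts; one plumbing `def` (`newtonRoot`). The genericity preprocessing (choice of the
coordinate `y`, reduction to a simple factor by `∂_y`, choice of the expansion point) and the
assembly into `KaltofenFactorBoundWith` are in `KaltofenFactorClosureProofs.lean`.

## References

* [Burgisser2004Factors] P. Bürgisser, *The complexity of factors of multivariate polynomials*,
  Found. Comput. Math. 4 (2004) 369–396 (arXiv:1812.06828), §3.2 (Newton iteration (3.3),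
  Prop. 3.4) and §3.3.
* [DuttaSaxenaSinhababu2018] P. Dutta, N. Saxena, A. Sinhababu, *Discovering the roots: uniform
  closure results for algebraic classes under factoring*, STOC 2018 (arXiv:1710.03214), §1.3 and
  the proof of Thm. 1 (factors as products of `y -` truncated power-series roots).
* [DvirShpilkaYehudayoff2009] Z. Dvir, A. Shpilka, A. Yehudayoff, SIAM J. Comput. 39 (2009),
  Lemma 3.1.
* [Kaltofen1989] E. Kaltofen, *Factorization of polynomials given by straight-line programs*,
  in: Randomness and Computation, JAI Press 1989, 375–412.
* [Burgisser2024Completeness] P. Bürgisser, *Completeness classes in algebraic complexity theory*,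
  arXiv:2406.06217, Thm. 3.2.
* [BurgisserClausenShokrollahi1997] Lemma (21.25) (homogeneous components).
-/

noncomputable section

namespace Literature.Computability.AlgebraicComplexity

open MvPolynomial Finset

namespace KaltofenFactor

/-! ### Vanishing order at the origin (private toolkit, as in `ApproximativeRootClosure`) -/

section Vanish

variable {F : Type*} [Field F] {β : Type*}

/-- Vanishing to order `j` in terms of the support. [folklore] -/
private theorem vanish_iff {j : ℕ} {p : MvPolynomial β F} :
    (∀ i < j, homogeneousComponent i p = 0) ↔ ∀ m ∈ p.support, j ≤ m.degree := by
  constructor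
  · intro h m hm
    by_contra hlt
    push Not at hlt
    have hc := congrArg (coeff m) (h _ hlt)
    rw [coeff_homogeneousComponent, if_pos rfl, coeff_zero] at hc
    exact (mem_support_iff.1 hm) hc
  · intro h i hi
    exact homogeneousComponent_eq_zero' _ _ fun m hm => by have := h m hm; omega

/-- Vanishing orders add under multiplication. [folklore] -/
private theorem vanish_mul {i j : ℕ} {p q : MvPolynomial β F}
    (hp : ∀ k < i, homogeneousComponent k p = 0) (hq : ∀ k < j, homogeneousComponent k q = 0) :
    ∀ k < i + j, homogeneousComponent k (p * q) = 0 := by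
  classical
  rw [vanish_iff] at hp hq ⊢
  intro m hm
  open Pointwise in
  obtain ⟨m₁, hm₁, m₂, hm₂, rfl⟩ := Finset.mem_add.1 (support_mul p q hm)
  rw [map_add]
  exact add_le_add (hp _ hm₁) (hq _ hm₂)

/-- A right factor does not lower the vanishing order. [folklore] -/
private theorem vanish_mul_right {i : ℕ} {p : MvPolynomial β F}
    (hp : ∀ k < i, homogeneousComponent k p = 0) (q : MvPolynomial β F) :
    ∀ k < i, homogeneousComponent k (p * q) = 0 := by
  have hq : ∀ k < 0, homogeneousComponent k q = 0 := fun k hk => absurd hk (Nat.not_lt_zero k)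
  simpa using vanish_mul hp hq

/-- A left factor does not lower the vanishing order. [folklore] -/
private theorem vanish_mul_left {i : ℕ} (q : MvPolynomial β F) {p : MvPolynomial β F}
    (hp : ∀ k < i, homogeneousComponent k p = 0) :
    ∀ k < i, homogeneousComponent k (q * p) = 0 := by
  rw [mul_comm]; exact vanish_mul_right hp q

/-- Sums. [folklore] -/
private theorem vanish_add {i : ℕ} {p q : MvPolynomial β F}
    (hp : ∀ k < i, homogeneousComponent k p = 0) (hq : ∀ k < i, homogeneousComponent k q = 0) :
    ∀ k < i, homogeneousComponent k (p + q) = 0 := fun k hk => by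
  rw [map_add, hp k hk, hq k hk, add_zero]

/-- Differences. [folklore] -/
private theorem vanish_sub {i : ℕ} {p q : MvPolynomial β F}
    (hp : ∀ k < i, homogeneousComponent k p = 0) (hq : ∀ k < i, homogeneousComponent k q = 0) :
    ∀ k < i, homogeneousComponent k (p - q) = 0 := fun k hk => by
  rw [map_sub, hp k hk, hq k hk, sub_zero]

/-- Finite sums. [folklore] -/
private theorem vanish_sum {i : ℕ} {ι : Type*} (s : Finset ι) {g : ι → MvPolynomial β F}
    (h : ∀ a ∈ s, ∀ k < i, homogeneousComponent k (g a) = 0) :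
    ∀ k < i, homogeneousComponent k (∑ a ∈ s, g a) = 0 := fun k hk => by
  rw [map_sum]
  exact Finset.sum_eq_zero fun a ha => h a ha k hk

/-- Weakening the order. [folklore] -/
private theorem vanish_mono {i j : ℕ} (hij : i ≤ j) {p : MvPolynomial β F}
    (hp : ∀ k < j, homogeneousComponent k p = 0) : ∀ k < i, homogeneousComponent k p = 0 :=
  fun k hk => hp k (lt_of_lt_of_le hk hij)

/-- Order `1` means vanishing constant term. [folklore] -/
private theorem vanish_one_iff (p : MvPolynomial β F) :
    (∀ k < 1, homogeneousComponent k p = 0) ↔ coeff 0 p = 0 := by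
  constructor
  · intro h
    have := h 0 Nat.zero_lt_one
    rwa [homogeneousComponent_zero, C_eq_zero] at this
  · intro h k hk
    obtain rfl : k = 0 := by omega
    rw [homogeneousComponent_zero, h, C_0]

/-- If `z ≡ w` to order `i` then `P(z) ≡ P(w)` to order `i`. [folklore] -/
private theorem vanish_eval_sub_eval {i : ℕ} (P : Polynomial (MvPolynomial β F))
    {z w : MvPolynomial β F} (h : ∀ k < i, homogeneousComponent k (z - w) = 0) :
    ∀ k < i, homogeneousComponent k (P.eval z - P.eval w) = 0 := by
  obtain ⟨t, ht⟩ := Polynomial.sub_dvd_eval_sub z w P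
  rw [ht]
  exact vanish_mul_right h t

/-- Constant terms agree when the difference vanishes to order `≥ 1`. [folklore] -/
private theorem coeff_zero_eq_of_vanish {i : ℕ} (hi : 1 ≤ i) {z w : MvPolynomial β F}
    (h : ∀ k < i, homogeneousComponent k (z - w) = 0) : coeff 0 z = coeff 0 w := by
  have := (vanish_one_iff _).1 (vanish_mono hi h)
  rwa [coeff_sub, sub_eq_zero] at this

/-- **Cancelling a factor with nonzero constant term** (Strassen's division trick): if `p · q`
vanishes to order `j` and `q(0) ≠ 0` then `p` vanishes to order `j`. [folklore] -/
private theorem vanish_of_mul_of_coeff_zero_ne_zero {j : ℕ} {p q : MvPolynomial β F}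
    (hq : coeff 0 q ≠ 0) (h : ∀ k < j, homogeneousComponent k (p * q) = 0) :
    ∀ k < j, homogeneousComponent k p = 0 := by
  set c := coeff 0 q with hc
  set u : MvPolynomial β F := 1 - C c⁻¹ * q with hu
  have hu1 : ∀ k < 1, homogeneousComponent k u = 0 := by
    rw [vanish_one_iff, hu, coeff_sub, coeff_zero_one, coeff_C_mul, ← hc,
      inv_mul_cancel₀ hq, sub_self]
  have huj : ∀ k < j, homogeneousComponent k (u ^ j) = 0 := by
    clear h
    induction j with
    | zero => intro k hk; exact absurd hk (Nat.not_lt_zero k)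
    | succ j ih => rw [pow_succ]; exact vanish_mul ih hu1
  have hgeom : C c⁻¹ * q * ∑ t ∈ range j, u ^ t = 1 - u ^ j := by
    have : C c⁻¹ * q = 1 - u := by rw [hu]; ring
    rw [this, mul_comm, geom_sum_mul_neg]
  have hid : p = p * q * (C c⁻¹ * ∑ t ∈ range j, u ^ t) + p * u ^ j := by
    have : p * q * (C c⁻¹ * ∑ t ∈ range j, u ^ t) = p * (C c⁻¹ * q * ∑ t ∈ range j, u ^ t) := by
      ring
    rw [this, hgeom]; ring
  rw [hid]
  exact vanish_add (vanish_mul_right h _) (vanish_mul_left p huj)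

/-- If `q ≡ g` to order `D + 1` and `deg g ≤ D`, the truncation of `q` at degree `D` is `g`.
[folklore] -/
private theorem sum_homogeneousComponent_eq_of_vanish {D : ℕ} {q g : MvPolynomial β F}
    (h : ∀ k < D + 1, homogeneousComponent k (q - g) = 0) (hD : g.totalDegree ≤ D) :
    ∑ i ∈ range (D + 1), homogeneousComponent i q = g := by
  have heq : ∀ i ∈ range (D + 1), homogeneousComponent i q = homogeneousComponent i g :=
    fun i hi => by
      have := h i (mem_range.1 hi)
      rwa [map_sub, sub_eq_zero] at this
  rw [sum_congr rfl heq]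
  calc ∑ i ∈ range (D + 1), homogeneousComponent i g
      = ∑ i ∈ range (g.totalDegree + 1), homogeneousComponent i g := by
        refine (Finset.sum_subset (Finset.range_mono (by omega)) fun i hi hi' => ?_).symm
        refine homogeneousComponent_eq_zero _ _ ?_
        simp only [mem_range, not_lt] at hi hi'
        omega
    _ = g := sum_homogeneousComponent g

/-- `rename some` (pushing `F[x]` into `F[x, y]`) preserves the vanishing order. [folklore] -/
private theorem vanish_rename_some {i : ℕ} {p : MvPolynomial β F}
    (hp : ∀ k < i, homogeneousComponent k p = 0) :
    ∀ k < i, homogeneousComponent k (rename some p : MvPolynomial (Option β) F) = 0 := by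
  classical
  rw [vanish_iff] at hp ⊢
  intro m hm
  rw [support_rename_of_injective (Option.some_injective β)] at hm
  obtain ⟨m', hm', rfl⟩ := Finset.mem_image.1 hm
  rw [Finsupp.degree_mapDomain]
  exact hp m' hm'

end Vanish

/-! ### The slow Newton iterate (plumbing definition) -/

section NewtonRoot

variable {F : Type*} [Field F] {β : Type*}

/-- **The `N`-th slow-Newton iterate of `φ ∈ F[x][Y]` started at the scalar `c`**:
`z_0 = c`, `z_{r+1} = z_r - ξ⁻¹ · φ(z_r)` with the FIXED scalar `ξ = (∂_Y φ)(c)(0)`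
(Dvir–Shpilka–Yehudayoff 2009, Lemma 3.1; Dutta–Saxena–Sinhababu 2018, §1.3 "slow Newton
iteration"; the iteration of the tree's `RootLifting.newton_iterate_vanish` /
`ApproximativeRootClosure.newton_iterate_residual_vanish`, named here). When `c` is a simple root
of `φ(0, Y)`, `φ(z_N)` vanishes to order `N + 1` and `z_N(0) = c` (`newtonRoot_spec`).
[cite: DuttaSaxenaSinhababu2018, §1.3] -/
def newtonRoot (φ : Polynomial (MvPolynomial β F)) (c : F) (N : ℕ) : MvPolynomial β F :=
  (fun w => w - C (coeff 0 ((Polynomial.derivative φ).eval (C c)))⁻¹ * φ.eval w)^[N] (C c)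

/-- Unfolding lemma. [cite: DuttaSaxenaSinhababu2018, §1.3 (slow Newton iteration)] -/
theorem newtonRoot_def (φ : Polynomial (MvPolynomial β F)) (c : F) (N : ℕ) :
    newtonRoot φ c N =
      (fun w => w - C (coeff 0 ((Polynomial.derivative φ).eval (C c)))⁻¹ * φ.eval w)^[N] (C c) :=
  rfl

/-- **Newton invariant, residual form** (specialisation of
`ApproximativeRootClosure.newton_iterate_residual_vanish`): at a simple root `c` of `φ(0, Y)`,
`z_N ≡ c (mod ⟨x⟩)` and `φ(z_N) ≡ 0 (mod ⟨x⟩^{N+1})`.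
[cite: Burgisser2004Factors, §3.2 (Newton iteration (3.3))] -/
theorem newtonRoot_spec (φ : Polynomial (MvPolynomial β F)) (c : F)
    (hc : coeff 0 (φ.eval (C c)) = 0)
    (hξ : coeff 0 ((Polynomial.derivative φ).eval (C c)) ≠ 0) (N : ℕ) :
    (∀ k < 1, homogeneousComponent k (newtonRoot φ c N - C c) = 0) ∧
      ∀ k < N + 1, homogeneousComponent k (φ.eval (newtonRoot φ c N)) = 0 :=
  newton_iterate_residual_vanish φ c hc rfl hξ N

/-- The constant term of every Newton iterate is the starting scalar (`g_i(0) = μ_i`).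
[cite: DuttaSaxenaSinhababu2018, Thm. 4 (power series complete split)] -/
theorem coeff_zero_newtonRoot (φ : Polynomial (MvPolynomial β F)) (c : F)
    (hc : coeff 0 (φ.eval (C c)) = 0)
    (hξ : coeff 0 ((Polynomial.derivative φ).eval (C c)) ≠ 0) (N : ℕ) :
    coeff 0 (newtonRoot φ c N) = c := by
  have := coeff_zero_eq_of_vanish le_rfl (newtonRoot_spec φ c hc hξ N).1
  rwa [coeff_zero_C] at this

/-- Constant terms are read off after evaluation at a constant: `(P(C c))(0) = P(0, ·)(c)`,
where `P(0, ·) = P.map constantCoeff`.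
[cite: DuttaSaxenaSinhababu2018, Thm. 4 (the specialisation `x ↦ 0`, `μ_i = g_i(0)`)] -/
theorem coeff_zero_eval_C (P : Polynomial (MvPolynomial β F)) (c : F) :
    coeff 0 (P.eval (C c)) = (P.map (constantCoeff : MvPolynomial β F →+* F)).eval c := by
  rw [← constantCoeff_eq, Polynomial.eval_map, Polynomial.eval, Polynomial.hom_eval₂,
    RingHom.comp_id, constantCoeff_C]

end NewtonRoot

/-! ### Interpolation modulo `⟨x⟩^N` -/

section Interpolation

variable {F : Type*} [Field F] {β : Type*}

/-- **Interpolation modulo `⟨x⟩^N`.** Let `z_c ∈ F[x]` (`c ∈ S`) have constant terms `z_c(0) = c`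
(so `z_c - z_a` has the nonzero scalar constant term `c - a` for `c ≠ a`). If `D ∈ F[x][Y]` has
degree `< #S` and every value `D(z_c)`, `c ∈ S`, vanishes to order `N`, then every coefficient of
`D` vanishes to order `N`. (Induction on `S`: `D = (Y - z_a) · D₁ + D(z_a)`, and at `c ≠ a` the
factor `z_c - z_a` cancels because its constant term is a nonzero scalar.) This is the uniqueness
half of the split `f(τx) ≡ ∏ (y - g_i^{≤t})^{γ_i} (mod I^{t+1})`.
[cite: DuttaSaxenaSinhababu2018, Thm. 4 and Cor. 5 (power series complete split, arXiv numbering)] -/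
theorem coeff_vanish_of_eval_vanish (N : ℕ) (z : F → MvPolynomial β F) (S : Finset F) :
    ∀ D : Polynomial (MvPolynomial β F), (∀ c ∈ S, coeff 0 (z c) = c) →
      D.degree < (S.card : WithBot ℕ) →
      (∀ c ∈ S, ∀ k < N, homogeneousComponent k (D.eval (z c)) = 0) →
      ∀ i, ∀ k < N, homogeneousComponent k (D.coeff i) = 0 := by
  classical
  induction S using Finset.induction_on with
  | empty =>
    intro D _ hdeg _ i k _
    have hD : D = 0 := by
      rw [Finset.card_empty, Nat.cast_zero, Nat.WithBot.lt_zero_iff, Polynomial.degree_eq_bot]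
        at hdeg
      exact hdeg
    rw [hD, Polynomial.coeff_zero, map_zero]
  | insert a S haS ih =>
    intro D hz hdeg hev
    set D₁ := D /ₘ (Polynomial.X - Polynomial.C (z a)) with hD₁
    set ρ := D.eval (z a) with hρ
    have hDeq : D = Polynomial.C ρ + (Polynomial.X - Polynomial.C (z a)) * D₁ := by
      have h := Polynomial.modByMonic_add_div D (Polynomial.X - Polynomial.C (z a))
      rw [Polynomial.modByMonic_X_sub_C_eq_C_eval] at h
      exact h.symm
    -- the degree of the quotient
    have hdeg₁ : D₁.degree < (S.card : WithBot ℕ) := by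
      by_cases hD0 : D = 0
      · rw [hD₁, hD0, Polynomial.zero_divByMonic, Polynomial.degree_zero]
        exact WithBot.bot_lt_coe _
      · have h1 : D₁.degree < D.degree :=
          Polynomial.degree_divByMonic_lt D _ hD0
            (by rw [Polynomial.degree_X_sub_C]; exact zero_lt_one)
        have h2 : D.degree ≤ (S.card : WithBot ℕ) := by
          rw [Finset.card_insert_of_notMem haS] at hdeg
          rw [Polynomial.degree_eq_natDegree hD0] at hdeg ⊢
          exact_mod_cast Nat.lt_succ_iff.1 (by exact_mod_cast hdeg)
        exact lt_of_lt_of_le h1 h2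
    have hza : coeff 0 (z a) = a := hz a (mem_insert_self a S)
    have hρv : ∀ k < N, homogeneousComponent k ρ = 0 := hev a (mem_insert_self a S)
    -- the quotient still vanishes at the other points
    have hev₁ : ∀ c ∈ S, ∀ k < N, homogeneousComponent k (D₁.eval (z c)) = 0 := by
      intro c hc
      have hca : c ≠ a := fun h => haS (h ▸ hc)
      have hq : coeff 0 (z c - z a) ≠ 0 := by
        rw [coeff_sub, hz c (mem_insert_of_mem hc), hza]
        exact sub_ne_zero.2 hca
      have hevc : D.eval (z c) - ρ = D₁.eval (z c) * (z c - z a) := by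
        conv_lhs => rw [hDeq]
        simp only [Polynomial.eval_add, Polynomial.eval_C, Polynomial.eval_mul,
          Polynomial.eval_sub, Polynomial.eval_X]
        ring
      have h := vanish_sub (hev c (mem_insert_of_mem hc)) hρv
      rw [hevc] at h
      exact vanish_of_mul_of_coeff_zero_ne_zero hq h
    have ih' := ih D₁ (fun c hc => hz c (mem_insert_of_mem hc)) hdeg₁ hev₁
    -- read off the coefficients of `D = C ρ + (Y - z_a) D₁`
    intro i
    rcases i with _ | j
    · have h0 : D.coeff 0 = ρ - z a * D₁.coeff 0 := by
        conv_lhs => rw [hDeq]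
        rw [Polynomial.coeff_add, Polynomial.coeff_C_zero, Polynomial.mul_coeff_zero,
          Polynomial.coeff_sub, Polynomial.coeff_X_zero, Polynomial.coeff_C_zero]
        ring
      rw [h0]
      exact vanish_sub hρv (vanish_mul_left _ (ih' 0))
    · have hj : D.coeff (j + 1) = D₁.coeff j - D₁.coeff (j + 1) * z a := by
        conv_lhs => rw [hDeq]
        rw [Polynomial.coeff_add, Polynomial.coeff_C, if_neg (Nat.succ_ne_zero j), zero_add,
          mul_comm, Polynomial.coeff_mul_X_sub_C]
      rw [hj]
      exact vanish_sub (ih' j) (vanish_mul_right (ih' (j + 1)) _)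

end Interpolation

/-! ### A monic factor is the product of its lifted roots modulo `⟨x⟩^{N+1}` -/

section Factor

variable {F : Type*} [Field F] {β : Type*}

/-- **A monic factor from its approximate roots.** Let `φ = P · Q` in `F[x][Y]` with `P` monic of
degree `#S`, where every `c ∈ S ⊆ F` is a root of `P(0, Y)` with `Q(0, c) ≠ 0` and
`∂_Y P(0, c) ≠ 0` (so the `#S` elements of `S` are exactly the simple roots of `P(0, Y)`, all of
them simple roots of `φ(0, Y)`). Then, with `z_c` the `N`-th slow-Newton iterate of `φ` from `c`,
EVERY COEFFICIENT of `P - ∏_{c ∈ S} (Y - z_c)` vanishes to order `N + 1` — i.e.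
`P ≡ ∏_{c ∈ S} (Y - z_c) (mod ⟨x⟩^{N+1})`. (The power-series roots of `P` are approximated by
Newton iteration on `φ`; `Q(z_c)` is a unit modulo `⟨x⟩`, so `P(z_c) ≡ 0`; then interpolation.)
[cite: Burgisser2004Factors, §3.2–§3.3; DuttaSaxenaSinhababu2018, §1.3 and proof of Thm. 1] -/
theorem coeff_sub_prod_newtonRoot_vanish (P Q : Polynomial (MvPolynomial β F)) (hP : P.Monic)
    (S : Finset F) (hS : S.card = P.natDegree)
    (hroot : ∀ c ∈ S, coeff 0 (P.eval (C c)) = 0)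
    (hQ : ∀ c ∈ S, coeff 0 (Q.eval (C c)) ≠ 0)
    (hP' : ∀ c ∈ S, coeff 0 ((Polynomial.derivative P).eval (C c)) ≠ 0) (N : ℕ) :
    ∀ i, ∀ k < N + 1, homogeneousComponent k
      ((P - ∏ c ∈ S, (Polynomial.X - Polynomial.C (newtonRoot (P * Q) c N))).coeff i) = 0 := by
  classical
  set z : F → MvPolynomial β F := fun c => newtonRoot (P * Q) c N with hz
  -- every `c ∈ S` is a simple root of `φ(0, Y)`
  have hstart : ∀ c ∈ S, coeff 0 ((P * Q).eval (C c)) = 0 := fun c hc => by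
    rw [Polynomial.eval_mul, ← constantCoeff_eq, map_mul, constantCoeff_eq, hroot c hc, zero_mul]
  have hsimple : ∀ c ∈ S, coeff 0 ((Polynomial.derivative (P * Q)).eval (C c)) ≠ 0 :=
    fun c hc => by
      rw [Polynomial.derivative_mul, Polynomial.eval_add, Polynomial.eval_mul,
        Polynomial.eval_mul, ← constantCoeff_eq, map_add, map_mul, map_mul, constantCoeff_eq,
        hroot c hc, zero_mul, add_zero]
      exact mul_ne_zero (hP' c hc) (hQ c hc)
  have hzc : ∀ c ∈ S, coeff 0 (z c) = c := fun c hc =>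
    coeff_zero_newtonRoot _ c (hstart c hc) (hsimple c hc) N
  -- `P(z_c)` vanishes to order `N + 1`
  have hPz : ∀ c ∈ S, ∀ k < N + 1, homogeneousComponent k (P.eval (z c)) = 0 := by
    intro c hc
    obtain ⟨h1, h2⟩ := newtonRoot_spec (P * Q) c (hstart c hc) (hsimple c hc) N
    have hQz : coeff 0 (Q.eval (z c)) ≠ 0 := by
      rw [coeff_zero_eq_of_vanish le_rfl (vanish_eval_sub_eval Q h1)]
      exact hQ c hc
    rw [Polynomial.eval_mul] at h2
    exact vanish_of_mul_of_coeff_zero_ne_zero hQz h2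
  -- the comparison polynomial
  set Pr : Polynomial (MvPolynomial β F) :=
    ∏ c ∈ S, (Polynomial.X - Polynomial.C (z c)) with hPr
  have hPrmonic : Pr.Monic :=
    Polynomial.monic_prod_of_monic _ _ fun c _ => Polynomial.monic_X_sub_C (z c)
  have hPrdeg : Pr.natDegree = S.card := by
    rw [hPr, Polynomial.natDegree_prod_of_monic _ _ fun c _ => Polynomial.monic_X_sub_C (z c)]
    simp only [Polynomial.natDegree_X_sub_C, sum_const, smul_eq_mul, mul_one]
  have hdeg : (P - Pr).degree < (S.card : WithBot ℕ) := by
    by_cases hPPr : P - Pr = 0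
    · rw [hPPr, Polynomial.degree_zero]; exact WithBot.bot_lt_coe _
    · have hP0 : P ≠ 0 := hP.ne_zero
      have hdP : P.degree = (S.card : WithBot ℕ) := by
        rw [Polynomial.degree_eq_natDegree hP0, hS]
      rw [← hdP]
      refine Polynomial.degree_sub_lt ?_ hP0 ?_
      · rw [hdP, Polynomial.degree_eq_natDegree hPrmonic.ne_zero, hPrdeg]
      · rw [hP.leadingCoeff, hPrmonic.leadingCoeff]
  have hev : ∀ c ∈ S, ∀ k < N + 1, homogeneousComponent k ((P - Pr).eval (z c)) = 0 := by
    intro c hc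
    have hPrz : Pr.eval (z c) = 0 := by
      rw [hPr, Polynomial.eval_prod]
      exact Finset.prod_eq_zero hc (by
        rw [Polynomial.eval_sub, Polynomial.eval_X, Polynomial.eval_C, sub_self])
    rw [Polynomial.eval_sub, hPrz, sub_zero]
    exact hPz c hc
  exact coeff_vanish_of_eval_vanish (N + 1) z S (P - Pr) hzc hdeg hev

end Factor

/-! ### Transport to `F[x, y]` and truncation -/

section Transport

variable {F : Type*} [Field F] {β : Type*}

/-- `optionEquivLeft.symm` on constants of `F[x][Y]` is `rename some`. [folklore] -/
private theorem optionEquivLeft_symm_polynomialC (u : MvPolynomial β F) :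
    (optionEquivLeft F β).symm (Polynomial.C u) = rename some u := by
  simp only [optionEquivLeft_symm_apply, Polynomial.aevalTower_C]

/-- If every coefficient of `D ∈ F[x][Y]` vanishes to order `N` (in `x`), then `D`, read in
`F[x, y]`, vanishes to (total) order `N`. [folklore] -/
private theorem vanish_optionEquivLeft_symm {N : ℕ} (D : Polynomial (MvPolynomial β F))
    (hD : ∀ i, ∀ k < N, homogeneousComponent k (D.coeff i) = 0) :
    ∀ k < N, homogeneousComponent k ((optionEquivLeft F β).symm D) = 0 := by
  classical
  have hexp : (optionEquivLeft F β).symm D =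
      ∑ j ∈ range (D.natDegree + 1), rename some (D.coeff j) * X none ^ j := by
    conv_lhs => rw [Polynomial.as_sum_range D]
    rw [map_sum]
    refine sum_congr rfl fun j _ => ?_
    rw [← Polynomial.C_mul_X_pow_eq_monomial, map_mul, map_pow]
    simp only [optionEquivLeft_symm_apply, Polynomial.aevalTower_C, Polynomial.aevalTower_X]
  rw [hexp]
  exact vanish_sum _ fun j _ => vanish_mul_right (vanish_rename_some (hD j)) _

/-- **The factor is the truncation of the product of its approximate linear factors.** If
`optionEquivLeft P̂ = a₀ · P`, every coefficient of `P - Π` vanishes to order `N + 1`, and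
`deg P̂ ≤ N`, then `P̂ = Σ_{k ≤ N} (a₀ · optionEquivLeft.symm Π)^{(k)}` — the factor is recovered
from the roots approximated "up to precision of degree" `N` (DSS §1.3, Cor. 5).
[cite: DuttaSaxenaSinhababu2018, Cor. 5 and §1.3 (reducing factoring to root approximation)] -/
theorem eq_sum_homogeneousComponent_of_coeff_vanish (Ph : MvPolynomial (Option β) F) (a₀ : F)
    (P Pr : Polynomial (MvPolynomial β F))
    (hPh : optionEquivLeft F β Ph = Polynomial.C (C a₀) * P) {N : ℕ}
    (hvan : ∀ i, ∀ k < N + 1, homogeneousComponent k ((P - Pr).coeff i) = 0)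
    (hdeg : Ph.totalDegree ≤ N) :
    Ph = ∑ k ∈ range (N + 1),
      homogeneousComponent k (C a₀ * (optionEquivLeft F β).symm Pr) := by
  have hPh' : Ph = C a₀ * (optionEquivLeft F β).symm P := by
    have := congrArg (optionEquivLeft F β).symm hPh
    rwa [AlgEquiv.symm_apply_apply, map_mul, optionEquivLeft_symm_C_C] at this
  have hdiff : C a₀ * (optionEquivLeft F β).symm Pr - Ph =
      -(C a₀ * (optionEquivLeft F β).symm (P - Pr)) := by
    rw [hPh', map_sub]; ring
  refine (sum_homogeneousComponent_eq_of_vanish ?_ hdeg).symm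
  rw [hdiff]
  intro k hk
  rw [map_neg, (vanish_mul_left (C a₀) (vanish_optionEquivLeft_symm (P - Pr) hvan)) k hk,
    neg_zero]

/-- The product of the linear factors, read in `F[x, y]`. [folklore] -/
private theorem optionEquivLeft_symm_prod_X_sub_C (S : Finset F) (z : F → MvPolynomial β F) :
    (optionEquivLeft F β).symm (∏ c ∈ S, (Polynomial.X - Polynomial.C (z c))) =
      ∏ c ∈ S, (X none - rename some (z c)) := by
  rw [map_prod]
  refine prod_congr rfl fun c _ => ?_
  rw [map_sub, optionEquivLeft_symm_X, optionEquivLeft_symm_polynomialC]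

end Transport

/-! ### The cost -/

section Cost

variable {F : Type*} [Field F] {β : Type*}

section NewtonCost

variable [Fintype β]

/-- Each Newton iterate costs `≤ N (L(G) + 2)` (`RootLifting.complexity_newton_iterate_le`).
[cite: DuttaSaxenaSinhababu2018, §1.3] -/
theorem complexity_newtonRoot_le (G : MvPolynomial (Option β) F) (c : F) (N : ℕ) :
    complexity (newtonRoot (optionEquivLeft F β G) c N) ≤ N * (complexity G + 2) :=
  complexity_newton_iterate_le G _ c N

end NewtonCost

/-- `L(y - u) ≤ L(u) + 2` for `u ∈ F[x]` pushed into `F[x, y]`. [folklore] -/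
private theorem complexity_X_none_sub_rename_le (u : MvPolynomial β F) :
    complexity (X none - rename some u : MvPolynomial (Option β) F) ≤ complexity u + 2 := by
  have h : (X none - rename some u : MvPolynomial (Option β) F) =
      X none + C (-1) * rename some u := by
    rw [map_neg, map_one, neg_one_mul, sub_eq_add_neg]
  rw [h]
  calc complexity (X none + C (-1) * rename some u : MvPolynomial (Option β) F)
      ≤ complexity (X none : MvPolynomial (Option β) F) +
          complexity (C (-1) * rename some u : MvPolynomial (Option β) F) + 1 :=
        complexity_add_le_holds _ _
    _ ≤ 0 + (complexity (C (-1) : MvPolynomial (Option β) F) +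
          complexity (rename some u : MvPolynomial (Option β) F) + 1) + 1 := by
        gcongr
        · exact (complexity_X_holds _).le
        · exact complexity_mul_le_holds _ _
    _ ≤ 0 + (0 + complexity u + 1) + 1 := by
        gcongr
        · exact (complexity_C_holds _).le
        · exact complexity_rename_le_holds' _ _
    _ = complexity u + 2 := by ring

/-- The product of the approximate linear factors costs `≤ #S · (M + 2) + #S + 1` when each root
costs `≤ M`. [folklore] -/
private theorem complexity_C_mul_prod_le (a₀ : F) (S : Finset F) (z : F → MvPolynomial β F) {M : ℕ}
    (hz : ∀ c ∈ S, complexity (z c) ≤ M) :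
    complexity (C a₀ * ∏ c ∈ S, (X none - rename some (z c)) : MvPolynomial (Option β) F) ≤
      S.card * (M + 2) + S.card + 1 := by
  calc complexity (C a₀ * ∏ c ∈ S, (X none - rename some (z c)) : MvPolynomial (Option β) F)
      ≤ complexity (C a₀ : MvPolynomial (Option β) F) +
          complexity (∏ c ∈ S, (X none - rename some (z c)) : MvPolynomial (Option β) F) + 1 :=
        complexity_mul_le_holds _ _
    _ ≤ 0 + (∑ c ∈ S, complexity (X none - rename some (z c) : MvPolynomial (Option β) F) +
          S.card) + 1 := by
        gcongr
        · exact (complexity_C_holds _).le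
        · exact complexity_finset_prod_le _ _
    _ ≤ 0 + (∑ _c ∈ S, (M + 2) + S.card) + 1 := by
        gcongr with c hc
        exact (complexity_X_none_sub_rename_le _).trans (by have := hz c hc; omega)
    _ = S.card * (M + 2) + S.card + 1 := by rw [sum_const, smul_eq_mul]; ring

variable [Fintype β]

/-- **The cost of a factor from root data (the engine of Kaltofen's theorem in the tree).** Let
`G, P̂ ∈ F[x_β, y]` with `optionEquivLeft G = P · Q` and `optionEquivLeft P̂ = a₀ · P`, `P` monic of
degree `#S`, where every `c ∈ S` is a root of `P(0, Y)` with `Q(0, c) ≠ 0 ≠ ∂_Y P(0, c)`. Then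
for every `N ≥ deg P̂`:
`L(P̂) ≤ (N+2)² · (#S · (N · (L(G) + 2) + 2) + #S + 1) + (N + 1)` —
`P̂` is the truncation at degree `N` of `a₀ ∏_{c ∈ S} (y - z_c)` with `z_c` the `N`-th Newton
iterates of `G` (`coeff_sub_prod_newtonRoot_vanish`, `eq_sum_homogeneousComponent_of_coeff_vanish`),
each costing `N (L(G) + 2)`, and the truncation costs `(N+2)² · L + N + 1` (BCS (21.25)).
[cite: Burgisser2004Factors, §3.2–§3.3; DuttaSaxenaSinhababu2018, proof of Thm. 1] -/
theorem complexity_le_of_rootData (G Ph : MvPolynomial (Option β) F) (a₀ : F)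
    (P Q : Polynomial (MvPolynomial β F)) (hP : P.Monic)
    (hG : optionEquivLeft F β G = P * Q)
    (hPh : optionEquivLeft F β Ph = Polynomial.C (C a₀) * P)
    (S : Finset F) (hS : S.card = P.natDegree)
    (hroot : ∀ c ∈ S, coeff 0 (P.eval (C c)) = 0)
    (hQ : ∀ c ∈ S, coeff 0 (Q.eval (C c)) ≠ 0)
    (hP' : ∀ c ∈ S, coeff 0 ((Polynomial.derivative P).eval (C c)) ≠ 0)
    {N : ℕ} (hN : Ph.totalDegree ≤ N) :
    complexity Ph ≤
      (N + 2) ^ 2 * (S.card * (N * (complexity G + 2) + 2) + S.card + 1) + (N + 1) := by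
  classical
  have hvan := coeff_sub_prod_newtonRoot_vanish P Q hP S hS hroot hQ hP' N
  have heq := eq_sum_homogeneousComponent_of_coeff_vanish Ph a₀ P
    (∏ c ∈ S, (Polynomial.X - Polynomial.C (newtonRoot (P * Q) c N))) hPh hvan hN
  have hprod : (optionEquivLeft F β).symm
      (∏ c ∈ S, (Polynomial.X - Polynomial.C (newtonRoot (P * Q) c N))) =
        ∏ c ∈ S, (X none - rename some (newtonRoot (P * Q) c N)) :=
    optionEquivLeft_symm_prod_X_sub_C S (fun c => newtonRoot (P * Q) c N)
  rw [hprod] at heq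
  have hzc : ∀ c ∈ S, complexity (newtonRoot (P * Q) c N) ≤ N * (complexity G + 2) :=
    fun c _ => by rw [← hG]; exact complexity_newtonRoot_le G c N
  have hprodc : complexity (C a₀ * ∏ c ∈ S, (X none - rename some (newtonRoot (P * Q) c N)) :
      MvPolynomial (Option β) F) ≤ S.card * (N * (complexity G + 2) + 2) + S.card + 1 :=
    complexity_C_mul_prod_le a₀ S (fun c => newtonRoot (P * Q) c N) hzc
  rw [heq]
  refine (complexity_sum_homogeneousComponent_le _ N).trans ?_
  exact Nat.add_le_add_right (Nat.mul_le_mul_left _ hprodc) _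

end Cost

end KaltofenFactor

end Literature.Computability.AlgebraicComplexity

end
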